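import Summits.Ventures.CertifiedManyBodySolver.Observables.StructureFactorsSumRules
import Literature.MathematicalPhysics.QuantumLattice.HubbardStaggeredMomentCeiling
import Literature.MathematicalPhysics.QuantumLattice.HubbardNNNHoppingClusterEmbedding

/-!
# The certificate-free range of the real-space spin correlator `C_s(r; ψ)`, `r ≠ 0`

HONEST FRAMING: first certified bounds; not a superconductivity verdict; every number certified or
labelled float.

Companion to `StructureFactorsSumRules` (the momentum-space ceilings).  For two DISTINCT orbital sites
`x ≠ y` of any finite lattice the operator inequalities
`-(3/8)(m_x + m_y) ≤ 𝐒_x·𝐒_y ≤ (1/4) m_x`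
hold (`m_x = n_x - 2 n_{x↑}n_{x↓}` the local moment): the lower one is `(𝐒_x + 𝐒_y)² ⪰ 0` on the
two-site sublattice (total spin `S(S+1) ≥ 0`, embedded with `fermionEmbed`), the upper one is the
singlet bound `𝐒_x·𝐒_y ≤ ¼ m_x m_y` plus `m_x m_y ≤ m_x`.  Summed over the torus they give, for every
displacement `r ≠ 0` and every vector `ψ`,
`-(3/4) Re⟨ψ, Σ_x m_x ψ⟩ ≤ Re⟨ψ, W_r ψ⟩ ≤ (1/4) Re⟨ψ, Σ_x m_x ψ⟩`, `W_r = Σ_x 𝐒_x·𝐒_{x+r}`,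
hence on a unit `N`-particle vector with total double occupancy `𝒟 = Re⟨ψ, Σ_x n_{x↑}n_{x↓} ψ⟩`
**`-(3/4)(N - 2𝒟)/L² ≤ C_s(r; ψ) ≤ (1/4)(N - 2𝒟)/L²`** (`spinCorr_mem_Icc_of_isNParticle`).
This is the "kinematic range" column of stripe_defs §5bis for the distance-class averages `C̄_s(R)`
(a class average of quantities each in the interval is in the interval): with the certified docc
window of the `4 × 4`, `N = 14`, `t′ = 0` torus (`𝒟 ≥ 0.3583`) it is `0.830 · [-3/4, 1/4]` per site
instead of the bare `[-3/4, 1/4]` (float evaluation; the inequalities are exact).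

References: elementary (two spin-½ moments: singlet `-3/4`, triplet `+1/4`); the operator forms are
assembled from the tree's `posSemidef_sum_sum_fermionSpinDot` [LiebPRL1989, Thm. 2],
`posSemidef_quarter_localMoment_mul_sub_fermionSpinDot` and `posSemidef_localMoment_sub_mul`
[EsslerEtAl2005, §2.2.5].
-/

namespace Summit.Ventures.CertifiedManyBodySolver.Observables

open Matrix Literature.MathematicalPhysics.QuantumLattice Literature.Probability.LatticeModels
open Literature.MathematicalPhysics.QuantumLattice.HubbardWave0
open Literature.MathematicalPhysics.QuantumLattice.FermionTorus
open Literature.MathematicalPhysics.QuantumLattice.FermionSpinMoment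
open scoped BigOperators ComplexConjugate ComplexOrder

section TwoSite

variable {Λ : Type*} [LinearOrder Λ] [Fintype Λ]

/-- **Triplet bound** `(3/4)(m_x + m_y) + 2 𝐒_x·𝐒_y ⪰ 0` (`x ≠ y`), i.e. `𝐒_x·𝐒_y ≥ -(3/8)(m_x + m_y)`:
the total spin of the two-site sublattice satisfies `(𝐒_x + 𝐒_y)² ⪰ 0`. -/
theorem posSemidef_localMoment_add_two_smul_fermionSpinDot {x y : Λ} (hxy : x ≠ y) :
    ((3 / 4 : ℂ) • (localMoment x + localMoment y) + (2 : ℂ) • fermionSpinDot x y).PosSemidef := by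
  -- the two-site embedding `Fin 2 ↪ Λ`, `0 ↦ x`, `1 ↦ y`
  obtain ⟨φ, hφ0, hφ1⟩ : ∃ φ : Fin 2 ↪ Λ, φ 0 = x ∧ φ 1 = y :=
    ⟨⟨![x, y], fun i j h => by
      fin_cases i <;> fin_cases j <;> simp_all [Matrix.cons_val_zero, Matrix.cons_val_one]⟩, rfl, rfl⟩
  have h := posSemidef_fermionEmbed φ (posSemidef_sum_sum_fermionSpinDot (Λ := Fin 2))
  rw [Fin.sum_univ_two, Fin.sum_univ_two, Fin.sum_univ_two, map_add, map_add, map_add,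
    fermionEmbed_fermionSpinDot, fermionEmbed_fermionSpinDot, fermionEmbed_fermionSpinDot,
    fermionEmbed_fermionSpinDot, hφ0, hφ1, fermionSpinDot_self, fermionSpinDot_self,
    fermionSpinDot_comm y x] at h
  convert h using 1
  module

/-- **Singlet bound** `(1/4) m_x - 𝐒_x·𝐒_y ⪰ 0` (`x ≠ y`), from `𝐒_x·𝐒_y ≤ ¼ m_x m_y` and
`m_x m_y ≤ m_x`. -/
theorem posSemidef_quarter_localMoment_sub_fermionSpinDot' {x y : Λ} (hxy : x ≠ y) :
    ((1 / 4 : ℂ) • localMoment x - fermionSpinDot x y).PosSemidef := by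
  have quarter_nonneg : (0 : ℂ) ≤ 1 / 4 := by
    rw [show (1 / 4 : ℂ) = ((1 / 4 : ℝ) : ℂ) by norm_num]
    exact Complex.zero_le_real.2 (by norm_num)
  have h := (posSemidef_quarter_localMoment_mul_sub_fermionSpinDot hxy).add
    ((posSemidef_localMoment_sub_mul x y).smul quarter_nonneg)
  convert h using 1
  rw [smul_sub]
  abel

end TwoSite

section Torus

variable (L : ℕ) [NeZero L]

/-- `x ≠ x + r` on the torus for `r ≠ 0`, transported through `ofTorusSite`. -/
theorem ofTorusSite_ne_ofTorusSite_add {r : TorusSite 2 L} (hr : r ≠ 0) (x : TorusSite 2 L) :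
    ofTorusSite x ≠ ofTorusSite (x + r) := by
  intro h
  have h' : x = x + r := (FermionTorus.equivTorusSite (d := 2) (L := L)).symm.injective h
  exact hr (left_eq_add.mp h')

/-- `Σ_x m_{x+r} = Σ_x m_x` (translation of the summation variable). -/
theorem sum_localMoment_add (r : TorusSite 2 L) :
    ∑ x : TorusSite 2 L, localMoment (ofTorusSite (x + r)) =
      ∑ x : TorusSite 2 L, (localMoment (ofTorusSite x) :
        Matrix (Finset (Orb (FermionTorus 2 L))) (Finset (Orb (FermionTorus 2 L))) ℂ) :=
  Fintype.sum_equiv (Equiv.addRight r) _ _ fun _ => rfl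

/-- **Lower operator bound**: `(3/2) Σ_x m_x + 2 W_r ⪰ 0` for `r ≠ 0`. -/
theorem posSemidef_sum_localMoment_add_two_smul_spinCorrSum {r : TorusSite 2 L} (hr : r ≠ 0) :
    ((3 / 2 : ℂ) • ∑ x : TorusSite 2 L, (localMoment (ofTorusSite x) :
        Matrix (Finset (Orb (FermionTorus 2 L))) (Finset (Orb (FermionTorus 2 L))) ℂ) +
      (2 : ℂ) • spinCorrSum L r).PosSemidef := by
  have h := posSemidef_finset_sum (Finset.univ : Finset (TorusSite 2 L)) fun x _ =>
    posSemidef_localMoment_add_two_smul_fermionSpinDot (ofTorusSite_ne_ofTorusSite_add L hr x)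
  simp only [smul_add, Finset.sum_add_distrib, ← Finset.smul_sum, sum_localMoment_add] at h
  convert h using 1
  rw [spinCorrSum]
  module

/-- **Upper operator bound**: `(1/4) Σ_x m_x - W_r ⪰ 0` for `r ≠ 0`. -/
theorem posSemidef_quarter_sum_localMoment_sub_spinCorrSum {r : TorusSite 2 L} (hr : r ≠ 0) :
    ((1 / 4 : ℂ) • ∑ x : TorusSite 2 L, (localMoment (ofTorusSite x) :
        Matrix (Finset (Orb (FermionTorus 2 L))) (Finset (Orb (FermionTorus 2 L))) ℂ) -
      spinCorrSum L r).PosSemidef := by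
  have h := posSemidef_finset_sum (Finset.univ : Finset (TorusSite 2 L)) fun x _ =>
    posSemidef_quarter_localMoment_sub_fermionSpinDot' (ofTorusSite_ne_ofTorusSite_add L hr x)
  convert h using 1
  rw [spinCorrSum, Finset.smul_sum, ← Finset.sum_sub_distrib]

omit [NeZero L] in
/-- `expect` is additive: `⟨ψ, (A - B) ψ⟩ = ⟨ψ, A ψ⟩ - ⟨ψ, B ψ⟩`. -/
private theorem expect_sub (A B : Matrix (Finset (Orb (FermionTorus 2 L))) (Finset (Orb (FermionTorus 2 L))) ℂ)
    (ψ : Fock (Orb (FermionTorus 2 L))) : expect (A - B) ψ = expect A ψ - expect B ψ := by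
  simp [expect, sub_mulVec, dotProduct_sub]

omit [NeZero L] in
/-- PSD ⇒ nonnegative real expectation. -/
private theorem re_expect_nonneg_of_posSemidef
    {P : Matrix (Finset (Orb (FermionTorus 2 L))) (Finset (Orb (FermionTorus 2 L))) ℂ}
    (hP : P.PosSemidef) (ψ : Fock (Orb (FermionTorus 2 L))) : 0 ≤ (expect P ψ).re := by
  obtain ⟨hre, -⟩ := Complex.nonneg_iff.mp (hP.dotProduct_mulVec_nonneg ψ)
  simpa [expect] using hre

/-- **`-(3/4) Re⟨ψ, Σ_x m_x ψ⟩ ≤ Re⟨ψ, W_r ψ⟩`** for `r ≠ 0` and every vector `ψ`. -/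
theorem neg_re_expect_sum_localMoment_le_spinCorrSum {r : TorusSite 2 L} (hr : r ≠ 0)
    (ψ : Fock (Orb (FermionTorus 2 L))) :
    -(3 / 4 : ℝ) * (expect (∑ x : TorusSite 2 L, (localMoment (ofTorusSite x) :
        Matrix (Finset (Orb (FermionTorus 2 L))) (Finset (Orb (FermionTorus 2 L))) ℂ)) ψ).re ≤
      (expect (spinCorrSum L r) ψ).re := by
  have h := re_expect_nonneg_of_posSemidef L (posSemidef_sum_localMoment_add_two_smul_spinCorrSum L hr) ψ
  rw [expect_add, expect_smul, expect_smul, Complex.add_re,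
    show (3 / 2 : ℂ) = ((3 / 2 : ℝ) : ℂ) by norm_num, show (2 : ℂ) = ((2 : ℝ) : ℂ) by norm_num,
    Complex.re_ofReal_mul, Complex.re_ofReal_mul] at h
  linarith

/-- **`Re⟨ψ, W_r ψ⟩ ≤ (1/4) Re⟨ψ, Σ_x m_x ψ⟩`** for `r ≠ 0` and every vector `ψ`. -/
theorem re_expect_spinCorrSum_le_quarter_sum_localMoment {r : TorusSite 2 L} (hr : r ≠ 0)
    (ψ : Fock (Orb (FermionTorus 2 L))) :
    (expect (spinCorrSum L r) ψ).re ≤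
      (1 / 4 : ℝ) * (expect (∑ x : TorusSite 2 L, (localMoment (ofTorusSite x) :
        Matrix (Finset (Orb (FermionTorus 2 L))) (Finset (Orb (FermionTorus 2 L))) ℂ)) ψ).re := by
  have h := re_expect_nonneg_of_posSemidef L (posSemidef_quarter_sum_localMoment_sub_spinCorrSum L hr) ψ
  rw [expect_sub L, expect_smul, Complex.sub_re, show (1 / 4 : ℂ) = ((1 / 4 : ℝ) : ℂ) by norm_num,
    Complex.re_ofReal_mul] at h
  linarith

/-- **The certificate-free range of `C_s(r; ψ)`, `r ≠ 0`, on a unit `N`-particle vector**: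
`-(3/4)(N - 2𝒟)/L² ≤ C_s(r; ψ) ≤ (1/4)(N - 2𝒟)/L²`, `𝒟 = Re⟨ψ, Σ_x n_{x↑}n_{x↓} ψ⟩`. -/
theorem spinCorr_mem_Icc_of_isNParticle {r : TorusSite 2 L} (hr : r ≠ 0) {N : ℕ}
    {ψ : Fock (Orb (FermionTorus 2 L))} (hψ : IsNParticle N ψ) (hnorm : star ψ ⬝ᵥ ψ = 1) :
    spinCorr L r ψ ∈ Set.Icc
      (-(3 / 4 : ℝ) * ((N : ℝ) - 2 * (expect (∑ x : TorusSite 2 L, (numberOp (ofTorusSite x) 0 * numberOp (ofTorusSite x) 1 :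
          Matrix (Finset (Orb (FermionTorus 2 L))) (Finset (Orb (FermionTorus 2 L))) ℂ)) ψ).re) / (L : ℝ) ^ 2)
      ((1 / 4 : ℝ) * ((N : ℝ) - 2 * (expect (∑ x : TorusSite 2 L, (numberOp (ofTorusSite x) 0 * numberOp (ofTorusSite x) 1 :
          Matrix (Finset (Orb (FermionTorus 2 L))) (Finset (Orb (FermionTorus 2 L))) ℂ)) ψ).re) / (L : ℝ) ^ 2) := by
  have hL : (0 : ℝ) < (L : ℝ) ^ 2 := by
    have : (0 : ℝ) < (L : ℝ) := by exact_mod_cast Nat.pos_of_ne_zero (NeZero.ne L)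
    positivity
  have hm : (expect (∑ x : TorusSite 2 L, (localMoment (ofTorusSite x) :
        Matrix (Finset (Orb (FermionTorus 2 L))) (Finset (Orb (FermionTorus 2 L))) ℂ)) ψ).re =
      (N : ℝ) - 2 * (expect (∑ x : TorusSite 2 L, (numberOp (ofTorusSite x) 0 * numberOp (ofTorusSite x) 1 :
          Matrix (Finset (Orb (FermionTorus 2 L))) (Finset (Orb (FermionTorus 2 L))) ℂ)) ψ).re := by
    rw [sum_localMoment_eq L, expect_add, expect_smul, Complex.add_re,
      re_expect_sum_siteDensity_of_isNParticle L hψ, hnorm, show (-2 : ℂ) = ((-2 : ℝ) : ℂ) by norm_num,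
      Complex.re_ofReal_mul]
    simp only [Complex.one_re, mul_one]
    ring
  have h1 := neg_re_expect_sum_localMoment_le_spinCorrSum L hr ψ
  have h2 := re_expect_spinCorrSum_le_quarter_sum_localMoment L hr ψ
  rw [hm] at h1 h2
  unfold spinCorr
  constructor
  · rw [← div_le_div_iff_of_pos_right hL] at h1
    simpa [neg_mul, neg_div] using h1
  · exact (div_le_div_iff_of_pos_right hL).mpr h2

end Torus

end Summit.Ventures.CertifiedManyBodySolver.Observables
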